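import Summits.RiemannHypothesis.RiemannHypothesis.Theorems.HandoffDodgerSmallPhi
import HarnessLib

/-!
# HANDOFF — SLAB THRESHOLD (5): the profile value at `y = 76` (rh-explicit, D-0040 WEIL column prover seat handoff-prove-2 gen13, ATTEMPT-23)

RH-FREE. HONEST FRAMING: nothing here bears on the truth of RH; part (5) of the discharge of the hypotheses of
`HandoffDodgerExplicit.dodger_witness_explicit` on the slab `30000 ≤ q < 60000` at the constant schedule `y = 76`:
the profile argument is the CONSTANT `x = 9y²/64 = 812.25`, so ONE partial sum suffices —
`Φ(812.25) ≥ Σ_{n ≤ 8} 812.25ⁿ/(n!(2n)!) ≥ 2.9·10⁶`, whence **`530000·(b+1.84)·e^{2b} < Φ²`** for `b ≤ 5.502`,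
`e^{2b} ≤ 60000` (left side `≤ 2.34·10¹¹ < 8.4·10¹²`).

References: this track (ATTEMPT-16 §1, ATTEMPT-21 §6, ATTEMPT-23 §2).
-/

set_option linter.dupNamespace false

noncomputable section

open Real Finset

namespace Summit.RiemannHypothesis.RiemannHypothesis.Theorems.Handoff

/-- `Σ_{n ≤ 8} xⁿ/(n!(2n)!) ≥ 2.9·10⁶` at `x = 812.25 = 9·76²/64`. [this track, ATTEMPT-23 §2] -/
theorem profileSum_ge_slab :
    (2900000 : ℝ) ≤ ∑ n ∈ range 9, ((3249 : ℝ) / 4) ^ n / ((n.factorial : ℝ) * ((2 * n).factorial : ℝ)) := by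
  simp only [sum_range_succ, sum_range_zero, Nat.factorial]
  norm_num

/-- **Part (5) of the slab discharge: the profile value at `y = 76`.** For `b ≤ 5.502`, `e^{2b} ≤ 60000` and
`Φ = Σ_m (9y²/64)^m/(m!(2m)!)` with `y = 76`: **`530000·(b+1.84)·e^{2b} < Φ²`**. [this track, ATTEMPT-23 §2] -/
theorem profile_value_slab {b y Φ : ℝ} (hb0 : 103 / 20 ≤ b) (hb1 : b ≤ 2751 / 500) (he' : Real.exp (2 * b) ≤ 60000)
    (hy : y = 76)
    (hΦ : HasSum (fun m : ℕ => (9 * y ^ 2 / 64) ^ m / ((m.factorial : ℝ) * ((2 * m).factorial : ℝ))) Φ) :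
    530000 * (b + 1.84) * Real.exp (2 * b) < Φ ^ 2 := by
  have hx : 9 * y ^ 2 / 64 = (3249 : ℝ) / 4 := by rw [hy]; norm_num
  rw [hx] at hΦ
  have hS := profileSum_le_of_hasSum (by norm_num : (0 : ℝ) ≤ 3249 / 4) hΦ 9
  have hΦge : (2900000 : ℝ) ≤ Φ := profileSum_ge_slab.trans hS
  have hE := Real.exp_pos (2 * b)
  have hb' : 0 ≤ 530000 * (b + 1.84) := by linarith
  have h1 : 530000 * (b + 1.84) * Real.exp (2 * b) ≤ 530000 * (2751 / 500 + 1.84) * 60000 :=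
    mul_le_mul (by linarith) he' hE.le (by norm_num)
  calc 530000 * (b + 1.84) * Real.exp (2 * b) ≤ 530000 * (2751 / 500 + 1.84) * 60000 := h1
    _ < 2900000 ^ 2 := by norm_num
    _ ≤ Φ ^ 2 := pow_le_pow_left₀ (by norm_num) hΦge 2

end Summit.RiemannHypothesis.RiemannHypothesis.Theorems.Handoff

end
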